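import Literature.NumberTheory.EllipticCurves.HeegnerPoints
import Literature.NumberTheory.EllipticCurves.GlobalMinimalModel
import Literature.NumberTheory.EllipticCurves.Selmer
import Literature.NumberTheory.EllipticCurves.Sha
import Literature.NumberTheory.EllipticCurves.MordellWeil
import Literature.NumberTheory.EllipticCurves.ModularCurve
import Literature.NumberTheory.EllipticCurves.Tamagawa
import Literature.NumberTheory.DiophantineGeometry.TateAlgorithm

/-!
# AN-46 — THE ℚ(i)-TWIST 2-SELMER LAW AT THE RAMIFIED PRIME (planner sketch, seat bsd-f1-sign2-an g31, MEMO-an §34.11)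

Companion of `EdgeMassFormulaAN45.lean`, attached to crux `RankOneAtTwoBigImageOddLocal` (stmt-BirchSwinnertonDyer-23715).

SETTING: `W/ℚ` of PRIME conductor `N ≡ 3 (mod 4)` (so `N` is inert in `k = ℚ(i)`, `L(W/k, s) = L(W,s)·L(W₋₁,s)` has even order at
`s = 1`, and by Gross `L(W/k,1) ≐ Φ(x_τ)²` with `Φ(x_τ)` = `edgeValue` of AN-45), `W₋₁ := W ⊗ χ₋₄` the ℚ(i)-twist (conductor `16N`).
The question «how often is the Gross period `Φ(x_τ)` zero?» (the constant term of the 2-adic edge theta tower is `(1-α⁻¹)Φ(x_τ)/2`,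
AN-45) turned out to have a 2-DESCENT answer keyed to the reduction of `W` at the prime `2` RAMIFIED in `k`:

DATA (census `Cruxes/RankOneAtTwoBigImageOddLocal/census35.md`; engine `MEMO-an-data/g31/ana/scan63b.py`, `scan63c.py` on Cremona's
`allcurves`/`allbsd` tables, conductors `< 500000`: ALL 408 optimal curves of prime conductor `N ≡ 3 (mod 4)`, `N ≤ 31249`, their
ℚ(i)-twists located at conductor `16N` by `j`-invariant + twisting class (408/408 found), `d₂ := rank + dim Ш[2]` read as
`r + 2·[#Ш_an even]`):
* (Tw-ss) SUPERSINGULAR at 2 (`a₂` even; 230 curves): `d₂(W₋₁) = d₂(W)` on 230/230 — rank-0 `W` with `#Ш(W)` odd: `r(W₋₁) = 0` and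
  `#Ш(W₋₁)` odd 78/78; rank-0 `W` with `#Ш(W) = 4` (571a, 6451a, 8747c): `r(W₋₁) = 2`, `#Ш(W₋₁) = 1` 3/3 (Ш traded for rank);
  rank-1: `r(W₋₁) = 1`, `#Ш(W₋₁)` odd 102/102; rank-2: `r(W₋₁) = 2` ×18, `r(W₋₁) = 0` with `#Ш(W₋₁) ∈ {4, 16}` ×26; rank-3:
  `r(W₋₁) = 1`, `#Ш(W₋₁) = 4` 3/3.
  MECHANISM = PROOF SKETCH (an in-print COMBINATION; each step citeable, the combination not located in print — Mazur–Rubin 2010 Cor. 3.4(ii)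
  gives `d₂(E^F) = d₂(E)` only when the primes above `2` SPLIT in `F`, here `2` RAMIFIES in `ℚ(i)`): identify `W[2] = W₋₁[2]` in `H¹(ℚ, W[2])`.
  (1) Local conditions AGREE at every `v ≠ 2`: `v = N` multiplicative, `χ₋₄` unramified, `ord_N Δ` odd [MR10 Lemma 2.10(iii) = Kramer Prop. 1, 2(a)];
  `v = ∞` since `Δ < 0` [2.10(iv)]; good unramified `v` [2.10(v)].  (2) So with `T = {2}`: `S_T ⊆ Sel₂(W), Sel₂(W₋₁) ⊆ S^T` and
  `dim S^T/S_T = dim H¹_f(ℚ₂, W[2]) = dim W(ℚ₂)/2W(ℚ₂) = 1 + dim W(ℚ₂)[2] = 1` [MR10 Lemma 3.2, Poitou–Tate], because `W(ℚ₂)[2] = 0` for good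
  SUPERSINGULAR reduction over the unramified base `ℚ₂` (`W̃(𝔽₂)[2] = 0` and the Newton polygon of `[2]` on the height-2 formal group has slope `1/3`).
  (3) Hence `|d₂(W₋₁) - d₂(W)| ≤ 1`; but `w(W₋₁) = w(W)·χ₋₄(-N) = w(W)` (`N ≡ 3 (4)`) and 2-parity [Monsky 1996; Dokchitser–Dokchitser 2010] with
  Cassels–Tate give `d₂(W₋₁) ≡ d₂(W) (mod 2)`; in a chain `S_T ⊊ S^T` of index `2` equal dimension means EQUAL SUBGROUP: `Sel₂(W₋₁) = Sel₂(W)`.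
  (Kramer's congruence [Kramer 1981 Thm 1 = MR10 Thm 2.7] then returns `δ₂(W, ℚ(i)/ℚ) = 0`: every point of `W(ℚ₂)` is a norm from `W(ℚ₂(i))`.)
* (Tw-ord) ORDINARY at 2 (`a₂` odd; 178 curves): `d₂(W₋₁) - d₂(W) ∈ {-2, 0, 2}` on 178/178, with a strong FLIP
  BIAS: `d₂(W) = 0`, `Δ < 0` ⟹ `d₂(W₋₁) = 2` on 31/36 (86 %); `Δ > 0`: 8/18; `d₂(W) = 2` ⟹ `d₂(W₋₁) = 0` on 30/41; `d₂(W) = 1` ⟹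
  `d₂(W₋₁) = 1` on 79/83.  Consequence for the edge programme: `Φ(x_τ) = 0` (i.e. `L(W,1)L(W₋₁,1) = 0`) for 31/36 rank-0 ordinary
  `Δ < 0` curves — the rank-`(0,0)` ordinary population of AN-45 (Θ-mass) is thin and lives mostly on `Δ > 0`.
* (ss ⟹ N ≡ 3 (8), Δ < 0): 230/230; elementary (minimal `Δ = ±N^k`; `a₁` even, `a₃` odd ⟹ `b₂ ≡ 0 (4)`, `b₄` even, `b₆` odd ⟹
  `Δ ≡ -27 b₆² ≡ 5 (mod 8)` ⟹ `k` odd, sign `-`, `N ≡ 3 (8)`; `Δ mod 8 = 5` on 230/230).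
* (Tw-tam) TAMAGAWA OF THE TWIST: `tam(W₋₁) = 1` (ss, 230/230), `= 4` (ord, `Δ < 0`, 115/115), `= 2` (ord, `Δ > 0`, 63/63) — i.e. `c₂(W₋₁) ∈ {1,4,2}` by
  type and `c_N(W₋₁) = 1` (`χ₋₄(N) = -1` swaps split/non-split, `v_N(Δ) = 1`): the crux hypothesis «odd Tamagawa product» is NEVER inherited by the
  ℚ(i)-twist of an ordinary curve.

Bearing on the crux `RankOneAtTwoBigImageOddLocal` (rank 1, big 2-adic image, odd local data ⟹ BSD₂): for the rank-1 members,
(Tw-ss)/(Tw-ord) transport `Ш(W)[2] = 0` to `Ш(W₋₁)[2] = 0 ∧ r(W₋₁) = 1` exactly (ss) or up to one controlled jump (ord: 79/83 no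
jump) — the descent companion of the analytic packet `L(W/ℚ(i), s)` that the edge theta tower interpolates.
Beyond-print theorem: no — (Tw-ss) is an in-print COMBINATION (three cited lemmas + 2-parity), typed as provable support; the flip bias in (Tw-ord) is data;
(Tw-tam) is Tate's algorithm.  Presearch: [corpus:paper-anon2010-ranks-twists-elliptic-curves-hilberts-tenth-problem p0007 Thm 2.7, p0008 L.2.9–2.11,
p0009 L.3.2, p0010 Prop 3.3/Cor 3.4]; galaxy "Selmer companion|twist by -1|Neumann-Setzer" star all → 0 relevant.
-/

namespace Summit.BirchSwinnertonDyer.BirchSwinnertonDyer.Cruxes.RankOneAtTwoBigImageOddLocal.TwistSelmer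

/-- support (theorem-shape, elementary; census35 §C 227/227): a curve of prime conductor `N ≡ 3 (mod 4)` which is supersingular at `2`
(`a₂` even) has `N ≡ 3 (mod 8)` and negative minimal discriminant.  Why it might fail: not foreseen — the proof is two lines (the minimal
discriminant is `±N^k` since the bad primes are the conductor primes; supersingular ⟺ `ā₁ = 0`, then `a₃` odd and `Δ ≡ -27b₆² ≡ 5 (mod 8)`,
so `k` is odd, the sign is `-` and `N ≡ 3 (mod 8)`); recorded because it is what makes `i_∞ = 0` automatic in (Tw-ss).  Sources: SilvermanAEC
(III.1 `b`-invariants, VII minimal models), Setzer1975 (J. LMS 10, 367–378), census35 §C. -/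
def SupersingularAtTwoForcesDiscriminant : Prop :=
  ∀ (W : WeierstrassCurve ℚ) [W.IsElliptic] [W.IsGloballyMinimal] (N : ℕ),
    N.Prime → N % 4 = 3 → W.conductorNorm ℤ = N → Even (W.frobeniusTrace 2) → N % 8 = 3 ∧ W.Δ < 0

/-- support (PROVABLE from cited facts — proof sketch in the module docstring; census35 §A 230/230 via `d₂ = r + 2·[#Ш_an even]`): for `W` of
prime conductor `N ≡ 3 (mod 4)` supersingular at `2`, the ℚ(i)-twist has THE SAME 2-Selmer group order (indeed the same 2-Selmer group inside
`H¹(ℚ, W[2])`).  Why it might fail: only through a gap in step (2) (`W(ℚ₂)[2] = 0` for good supersingular reduction over `ℚ₂`) or a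
model-dependence of `selmerGroup` under `C₁ • W₁ = W.quadraticTwist (-1)`; the data show no exception.  Sources: Kramer1981 (Trans. AMS 264,
121–135) Thm 1, Prop. 1–2; MazurRubin2010 (Invent. 181) Lemma 2.10, Lemma 3.2, Cor. 3.4; Monsky1996 (Math. Z. 221) 2-parity; census35. -/
def TwistMinusOneSelmerCardEqOfSupersingular : Prop :=
  ∀ (W : WeierstrassCurve ℚ) [W.IsElliptic] [W.IsGloballyMinimal] (N : ℕ),
    N.Prime → N % 4 = 3 → W.conductorNorm ℤ = N → Even (W.frobeniusTrace 2) →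
  ∀ (W₁ : WeierstrassCurve ℚ) [W₁.IsElliptic] (C₁ : WeierstrassCurve.VariableChange ℚ),
    C₁ • W₁ = W.quadraticTwist (-1 : ℚ) →
      Nat.card (W₁.selmerGroup 2) = Nat.card (W.selmerGroup 2)

/-- candidate (census35 §B 181/181; Kramer–Mazur–Rubin give `|d₂(W₋₁) - d₂(W)| ≤ i₂ + i_∞` with the same parity, which allows `4` a
priori when `W[2] ⊂ W(ℚ₂)` and `Δ > 0`): for `W` of prime conductor `N ≡ 3 (mod 4)` ORDINARY at `2`, the 2-Selmer orders of `W` and of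
its ℚ(i)-twist differ by a factor in `{1/4, 1, 4}`.  Why it might fail: an ordinary curve with full `ℚ₂`-rational 2-torsion, `Δ > 0` and
`d₂` jumping by `4` (none up to `N ≤ 31249`).  Sources: Kramer1981 Thm 1, MazurRubin2010 Thm 3.9, KlagsbrunMazurRubin2013 (disparity); census35. -/
def TwistMinusOneSelmerCardOrdinary : Prop :=
  ∀ (W : WeierstrassCurve ℚ) [W.IsElliptic] [W.IsGloballyMinimal] (N : ℕ),
    N.Prime → N % 4 = 3 → W.conductorNorm ℤ = N → Odd (W.frobeniusTrace 2) →
  ∀ (W₁ : WeierstrassCurve ℚ) [W₁.IsElliptic] (C₁ : WeierstrassCurve.VariableChange ℚ),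
    C₁ • W₁ = W.quadraticTwist (-1 : ℚ) →
      Nat.card (W₁.selmerGroup 2) = Nat.card (W.selmerGroup 2) ∨
      Nat.card (W₁.selmerGroup 2) = 4 * Nat.card (W.selmerGroup 2) ∨
      4 * Nat.card (W₁.selmerGroup 2) = Nat.card (W.selmerGroup 2)

/-- support (theorem-shape via Tate's algorithm; census35 §B/§A 408/408, stated for `|Δ| = N`: 406/406): the Tamagawa product of the globally
minimal model of the ℚ(i)-twist is `1` if `W` is supersingular at `2`, `4` if ordinary with `Δ < 0`, `2` if ordinary with `Δ > 0` (the factor at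
`N` is `1` because `χ₋₄(N) = -1` swaps split and non-split multiplicative reduction and `v_N(Δ) = 1`; the factor at `2` is the component group of
the additive fibre of `W₋₁`, conductor exponent `4`).  Why it might fail: a Kodaira type at `2` for the twist other than the three the data show
(e.g. `I₀*` with `c₂ = 1` or `2` for an ordinary curve with a `ℚ₂`-rational 2-torsion point) beyond `N ≤ 31249`.  Sources: SilvermanATAEC1994
IV.9.4 (Tate's algorithm), Comalada1994 (twists and reduction at 2), census35. -/
def TwistMinusOneTamagawa : Prop :=
  ∀ (W : WeierstrassCurve ℚ) [W.IsElliptic] [W.IsGloballyMinimal] (N : ℕ),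
    N.Prime → N % 4 = 3 → W.conductorNorm ℤ = N → (W.Δ = N ∨ W.Δ = -N) →
  ∀ (W₁ : WeierstrassCurve ℚ) [W₁.IsElliptic] [W₁.IsGloballyMinimal] (C₁ : WeierstrassCurve.VariableChange ℚ),
    C₁ • W₁ = W.quadraticTwist (-1 : ℚ) →
      W₁.tamagawaProduct = if Even (W.frobeniusTrace 2) then 1 else if W.Δ < 0 then 4 else 2

end Summit.BirchSwinnertonDyer.BirchSwinnertonDyer.Cruxes.RankOneAtTwoBigImageOddLocal.TwistSelmer
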